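import Literature.AnabelianGeometry.EtaleTheta.Discharge.Sec3Thm37UnitProfiniteOfDivisorial
import Literature.AnabelianGeometry.EtaleTheta.Discharge.Sec3Thm37UnitsWeak
import HarnessLib

/-!
# [EtTh] Theorem 3.7 (i) unit conjuncts and (iv) at the WEAK constructed Def. 3.6 (i) data WITHOUT `hF` / `hBmon`
# (`ofRlfRWeak`: UNCONDITIONAL at the canonical vocabulary; `ofRlfZWeak`: from the Prop. 3.4 (ii) isomorphisms ALONE)

S. Mochizuki, *The étale theta function …*, Publ. RIMS **45** (2009) [MochizukiEtTh2009], Thm. 3.7 (i)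
"if `Λ = ℤ` (resp. `Λ = ℝ`), then `C` is of unit-profinite (resp. unit-trivial) type", Thm. 3.7 (iv) "`D` slim,
`Λ ∈ {ℤ, ℝ}` ⇒ `C` slim", PDF pp. 79–80 (printed 305–306); Prop. 3.4 (ii) p.74.

WEAK-VOCABULARY TWIN of the constructor sections of abc-iut-f-047's `Discharge/Sec3Thm37UnitsOfDivisorial.lean`
(§OfRlfR: `thm37_i_unitTrivial_ofRlfR_of_isDivisorial`, `thm37_iv_ofRlfR_of_isDivisorial`,
`thm37_i_unitTrivial_ofRlfR_treeCatVocab_holds`, `thm37_i_unitConjuncts_ofRlfR_treeCatVocab_holds`,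
`thm37_iv_ofRlfR_treeCatVocab_holds`) and `Sec3Thm37UnitProfiniteOfDivisorial.lean` (§OfRlfZ:
`thm37_i_unitProfinite_and_iv_ofRlfZ_treeCatVocab_of_kerIsoPadicUnits`).  Their vocabulary-generic cores
(`thm37_i_unitTrivial_of_isDivisorial`, `thm37_iv_of_isDivisorial_of_divΛ_injective`,
`isOfUnitProfiniteType_of_isDivisorial_of_kerIsoPadicUnits`, `thm37_iv_of_isDivisorial_of_kerIsoPadicUnits`: divisorial
`Φ(A)` replaces the [FrdI] Thm 5.2 (ii) input `hF` / `hBmon`) are consumed BY NAME at abc-iut-L6-t12's weak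
constructors `ofRlfRWeak` / `ofRlfZWeak` (the `Ÿ` / `Z_∞`-type data, F-L2d2-1), SUPERSEDING the `hF` / `hBmon`-bound
forms of `Sec3Thm37UnitsWeak.lean` (same seat, gen 3) exactly as the strong `…_holds` forms supersede theirs:

* `thm37_i_unitTrivial_ofRlfRWeak_of_isDivisorial`, `thm37_iv_ofRlfRWeak_of_isDivisorial` (any category vocabulary,
  divisorial `Φ(A)`, no `hF`);
* **`thm37_i_unitTrivial_ofRlfRWeak_treeCatVocab_holds`, `thm37_i_unitConjuncts_ofRlfRWeak_treeCatVocab_holds`,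
  `thm37_iv_ofRlfRWeak_treeCatVocab_holds` — UNCONDITIONAL** at the canonical [FrdI] category vocabulary (`Φ(A)`
  divisorial is the Def. 3.6 (ii) field there);
* **`thm37_i_unitProfinite_and_iv_ofRlfZWeak_treeCatVocab_of_kerIsoPadicUnits`** — `Λ = ℤ`: unit-profinite type and
  (iv) from the Prop. 3.4 (ii) isomorphisms `Ker(B₀(Y_A)^× → (Φ₀^ℝ)^gp) ≅ O_L^×` (`hP34`) ALONE, no `hBmon`.
(Every tempered Frobenioid is bound IN its statement, so that no statement is textually its strong twin.)  Seat abc-iut-L6-t12 (gen 4), cell abc-iut, row «§3 WEAK COLUMN at Λ = ℚ/ℝ» piece (W9).  PROOF-ONLY (0 defs).  HONEST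
FRAMING: refereed pre-IUT material; nothing here bears on [IUTchIII] Cor. 3.12; typed ≠ proved — here PROVED.
-/

noncomputable section

namespace Literature.AnabelianGeometry.EtaleTheta

open CategoryTheory Opposite Literature.AlgebraicGeometry.Frobenioids

universe u₀ v₀ u v w uK

namespace TemperedFrobenioid

/-! ### Monoid type `ℝ`: `ofRlfRWeak` -/

section OfRlfRWeak

variable {D₀ : Type u₀} [Category.{v₀} D₀] (dm : DivisorMonoids.{u₀, v₀, w} D₀)
  (hpf : ∀ Y : D₀ᵒᵖ, IsPerfFactorialCof (dm.Φ₀.obj Y)) {D : Type u} [Category.{v} D]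

section AnyVocab

variable {VD : FrdICatStub.{u, v, w} D}

/-- **Thm. 3.7 (i), "unit-trivial type", for every tempered Frobenioid of monoid type `ℝ` over the weak constructed
data `ofRlfRWeak`**, for divisorial `Φ(A_D)` (no `hF`): `B₀^ℝ → (Φ₀^ℝ)^gp` is injective
(`ofRlfRWeak_divΛ_injective`). [cite: MochizukiEtTh2009, Thm 3.7 p.79] -/
theorem thm37_i_unitTrivial_ofRlfRWeak_of_isDivisorial
    (C₀ : TemperedFrobenioid (RealifiedDivisorMonoids.ofRlfRWeak dm hpf) D VD)
    (hΦ : ∀ A : D, IsDivisorial (C₀.divisorMonoid.obj (op A))) :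
    PreFrobenioid.IsOfType (PreFrobenioid.IsUnitTrivial C₀.toElem) :=
  C₀.thm37_i_unitTrivial_of_isDivisorial hΦ fun A =>
    RealifiedDivisorMonoids.ofRlfRWeak_divΛ_injective dm hpf (C₀.baseOp A)

/-- **Thm. 3.7 (iv) for every tempered Frobenioid of monoid type `ℝ` over the weak data `ofRlfRWeak`**, for divisorial
`Φ(A_D)` (no `hF`). [cite: MochizukiEtTh2009, Thm 3.7 p.80] -/
theorem thm37_iv_ofRlfRWeak_of_isDivisorial
    (C₀ : TemperedFrobenioid (RealifiedDivisorMonoids.ofRlfRWeak dm hpf) D VD)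
    (hΦ : ∀ A : D, IsDivisorial (C₀.divisorMonoid.obj (op A))) :
    TemperedFrobenioid.Thm37_iv (T := RealifiedDivisorMonoids.ofRlfRWeak dm hpf) C₀ :=
  C₀.thm37_iv_of_isDivisorial_of_divΛ_injective hΦ fun A =>
    RealifiedDivisorMonoids.ofRlfRWeak_divΛ_injective dm hpf (C₀.baseOp A)

end AnyVocab

section TreeVocab

variable {IsRational IsStrictlyRational : (Dᵒᵖ ⥤ CommMonCat.{w}) → Prop}

/-- **Thm. 3.7 (i), "unit-trivial type" for monoid type `ℝ` over the weak data `ofRlfRWeak` at the canonical [FrdI]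
category vocabulary — UNCONDITIONAL** (supersedes gen 3's `thm37_i_unitTrivial_ofRlfRWeak_treeCatVocab (hBmon)`).
[cite: MochizukiEtTh2009, Thm 3.7 p.79] -/
theorem thm37_i_unitTrivial_ofRlfRWeak_treeCatVocab_holds
    (C : TemperedFrobenioid (RealifiedDivisorMonoids.ofRlfRWeak dm hpf) D
      (treeCatVocab D IsRational IsStrictlyRational)) :
    PreFrobenioid.IsOfType (PreFrobenioid.IsUnitTrivial C.toElem) :=
  thm37_i_unitTrivial_ofRlfRWeak_of_isDivisorial dm hpf C C.isDivisorial_divisorMonoid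

/-- The two UNIT conjuncts of Thm 3.7 (i) for such data and ANY facade `F` (the `Λ = ℤ` conjunct is vacuous: the
monoid type is `ℝ`) — UNCONDITIONAL. [cite: MochizukiEtTh2009, Thm 3.7 p.79] -/
theorem thm37_i_unitConjuncts_ofRlfRWeak_treeCatVocab_holds
    (C₀ : TemperedFrobenioid (RealifiedDivisorMonoids.ofRlfRWeak dm hpf) D
      (treeCatVocab D IsRational IsStrictlyRational)) (F : FrobenioidFacade.{u, v, w} D) :
    (C₀.monoidType = MonoidType.Z → F.IsOfUnitProfiniteType C₀.toElem) ∧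
      (C₀.monoidType = MonoidType.R →
        PreFrobenioid.IsOfType (PreFrobenioid.IsUnitTrivial C₀.toElem)) :=
  ⟨fun h => absurd ((monoidType_ofRlfRWeak dm hpf C₀).symm.trans h) (by decide),
    fun _ => thm37_i_unitTrivial_ofRlfRWeak_treeCatVocab_holds dm hpf C₀⟩

/-- **Thm. 3.7 (iv) "`D` slim ⟹ `C` slim" for monoid type `ℝ` over the weak data `ofRlfRWeak` at the canonical
[FrdI] category vocabulary — UNCONDITIONAL** (supersedes gen 3's `thm37_iv_ofRlfRWeak_treeCatVocab (hBmon)`).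
[cite: MochizukiEtTh2009, Thm 3.7 p.80] -/
theorem thm37_iv_ofRlfRWeak_treeCatVocab_holds
    (C : TemperedFrobenioid (RealifiedDivisorMonoids.ofRlfRWeak dm hpf) D
      (treeCatVocab D IsRational IsStrictlyRational)) :
    TemperedFrobenioid.Thm37_iv (T := RealifiedDivisorMonoids.ofRlfRWeak dm hpf) C :=
  thm37_iv_ofRlfRWeak_of_isDivisorial dm hpf C C.isDivisorial_divisorMonoid

end TreeVocab

end OfRlfRWeak

/-! ### Monoid type `ℤ`: `ofRlfZWeak` -/

section OfRlfZWeak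

variable {D₀ : Type u₀} [Category.{v₀} D₀] (dm : DivisorMonoids.{u₀, v₀, w} D₀)
  (hpf : ∀ Y : D₀ᵒᵖ, IsPerfFactorialCof (dm.Φ₀.obj Y)) {D : Type u} [Category.{v} D]
  {IsRational IsStrictlyRational : (Dᵒᵖ ⥤ CommMonCat.{w}) → Prop}
  (C₁ : TemperedFrobenioid (RealifiedDivisorMonoids.ofRlfZWeak dm hpf) D
    (treeCatVocab D IsRational IsStrictlyRational)) {p : ℕ} [Fact p.Prime]

/-- For the weak CONSTRUCTED Def. 3.6 (i) data of monoid type `ℤ` (`ofRlfZWeak`) at the canonical vocabulary: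
**Thm. 3.7 (i) "unit-profinite type" and Thm. 3.7 (iv) from the Prop. 3.4 (ii) isomorphisms
`Ker(B₀(Y_A)^× → (Φ₀^ℝ)^gp) ≅ O_L^×` ALONE** — no `hBmon` (supersedes gen 3's
`thm37_i_unitProfinite_and_iv_ofRlfZWeak_treeCatVocab (hBmon)`). [cite: MochizukiEtTh2009, Thm 3.7 p.80] -/
theorem thm37_i_unitProfinite_and_iv_ofRlfZWeak_treeCatVocab_of_kerIsoPadicUnits
    (hP34 : ∀ A : Dᵒᵖ, ∃ L : PadicFrd.PadicFld.{uK} p, L.IsPadicLocal ∧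
      Nonempty ((((RealifiedDivisorMonoids.ofRlfZWeak dm hpf).divΛ (C₁.baseOp A)).comp
        (Units.coeHom ((RealifiedDivisorMonoids.ofRlfZWeak dm hpf).BΛ.obj (C₁.baseOp A)))).ker ≃*
        PadicFrd.unitSubgroup L.K)) :
    PreFrobenioid.IsOfUnitProfiniteType C₁.toElem ∧
      TemperedFrobenioid.Thm37_iv (T := RealifiedDivisorMonoids.ofRlfZWeak dm hpf) C₁ :=
  ⟨C₁.isOfUnitProfiniteType_of_isDivisorial_of_kerIsoPadicUnits C₁.isDivisorial_divisorMonoid hP34,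
    C₁.thm37_iv_of_isDivisorial_of_kerIsoPadicUnits C₁.isDivisorial_divisorMonoid hP34⟩

end OfRlfZWeak

end TemperedFrobenioid

end Literature.AnabelianGeometry.EtaleTheta

end
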